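import Summits.AtomisticToContinuum.BoseEinsteinCondensation.Theorems.BECThomsonPrincipleGDTransferSeededPlainInteractionPairs

/-!
# Route `BECThomsonPrinciple`, crux `GDTransfer` (stmt-AtomisticToContinuum-9482), line `seeded-continuity`:
# stub `stub_plainInteraction`, part 3 of 4 — the local terms and the local bound of one pair

Support file (part 3 of 4) of the registered stub `stub_plainInteraction` (`PlainInteractionBound`), continuing parts
1–2 (`…SeededPlainInteractionForms`, `…SeededPlainInteractionPairs`).  For one pair `{p,q}` (`p ≠ q`) with the pair
weight `v^per(x_p − x_q)` and the four `(i,j)`-indexed terms `t₁ = 𝓥_pq(b_iψ, b_jψ)`, `t₂ = 𝓥_pq(P_i^{(n)}ψ, P_j^{(n)}ψ)`,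
`t₃ = 𝓥_pq(b_iP_j^{(n)}ψ, ψ)`, `t₄ = 𝓥_pq(P_i^{(n)}b_jψ, ψ)`:
* rows `i ∉ {p,q}` are purely imaginary (`t₁ = conj t₄`, `t₂ = conj t₃`: adjointness of `b_i`, `P_i^{(n)}` against the
  pair weight, which is flat in slot `i`), entries `i ∈ {p,q} ∌ j` vanish (`t₁ = t₃`, `t₂ = t₄`: adjointness in slot `j`
  and the mixed commutation `b_iP_j^{(n)} = P_j^{(n)}b_i`), and the four local entries `i, j ∈ {p,q}` obey
  `|t₁|, |t₂| ≤ L⁻³‖v‖₁`, `|t₃|, |t₄| ≤ √(L⁻³‖v‖₁)√(∫v^per_pq|ψ|²)` (Jensen in a slot of the pair and weighted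
  Cauchy–Schwarz: `pair_local_bounds`);
* the `(i,j)`-EXPANSION of the double-commutator form for a continuous weight (`bracket_expand`, sesquilinearity and
  `P_i`, `P_i^{(n)}` through finite sums);
* THE LOCAL BOUND OF ONE PAIR `|Re 𝒟^{pq}| ≤ 8L⁻³‖v‖₁ + 8√(L⁻³‖v‖₁)√(∫v^per_pq|ψ|²)` for continuous `ψ` with
  `∫|ψ|² ≤ 1` (`abs_re_pairBracket_le`; registered helper statement `plainInteraction_abs_re_pairBracket_le`).
All [folklore] (KennedyLiebShastry1988 §2; arXiv:1211.2778 §2; LSSY2005 App. A).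
-/

noncomputable section

open MeasureTheory Filter
open scoped ENNReal NNReal ComplexConjugate

namespace Summit.AtomisticToContinuum.BoseEinsteinCondensation.Cruxes.GDTransfer.Seeded

namespace PlainInteraction

open Literature.MathematicalPhysics.QuantumManyBody.BoseGas
open Summit.AtomisticToContinuum.BoseEinsteinCondensation.Theorems.GaussianDominationCan.Negative
open Summit.AtomisticToContinuum.BoseEinsteinCondensation.Cruxes.GDTransfer.DysonDressedWitness
open Lnss Sector

variable {N m : ℕ} {L : ℝ}

/-! ## The local terms of one pair: adjointness rows, vanishing entries, bounds -/

section OnePair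

variable {v : ℝ → ℝ≥0∞} {n : Fin 3 → ℤ} {p q : Fin (m + 1)} {ψ : Config (m + 1) → ℂ}

/-- **Rows `i ∉ {p,q}` are purely imaginary, first half**: `𝓥_pq(b_iψ, b_jψ) = conj 𝓥_pq(P_i^{(n)}(b_jψ), ψ)`
(adjointness of `b_i` against the pair weight, which is flat in slot `i`). [folklore] -/
theorem pair_t1_eq_conj_t4 (hv : IsRepulsiveFiniteRange v) (hfc : IsFiniteContinuous v) (hL : L ≠ 0)
    (n : Fin 3 → ℤ) {i : Fin (m + 1)} (hip : p ≠ i) (hiq : q ≠ i) (j : Fin (m + 1)) (hψ : Continuous ψ) :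
    ∫ X in cellN (m + 1) L, (((periodizedPotential v L (X p - X q)).toReal : ℝ) : ℂ) *
        (conj (cellWave L n (X i) * cellAvg (m + 1) L i ψ X) * (cellWave L n (X j) * cellAvg (m + 1) L j ψ X)) =
      conj (∫ X in cellN (m + 1) L, (((periodizedPotential v L (X p - X q)).toReal : ℝ) : ℂ) *
        (conj (fourierAvg m L n i (fun Y => cellWave L n (Y j) * cellAvg (m + 1) L j ψ Y) X) * ψ X)) := by
  rw [form_up_adjoint n i (continuous_pairWeight hv hfc hL p q) (pairWeight_update v L hip hiq) hψ
    (continuous_up n j hψ), form_conj_symm]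

/-- **Rows `i ∉ {p,q}` are purely imaginary, second half**: `𝓥_pq(P_i^{(n)}ψ, P_j^{(n)}ψ) = conj 𝓥_pq(b_i(P_j^{(n)}ψ), ψ)`.
[folklore] -/
theorem pair_t2_eq_conj_t3 (hv : IsRepulsiveFiniteRange v) (hfc : IsFiniteContinuous v) (hL : L ≠ 0)
    (n : Fin 3 → ℤ) {i : Fin (m + 1)} (hip : p ≠ i) (hiq : q ≠ i) (j : Fin (m + 1)) (hψ : Continuous ψ) :
    ∫ X in cellN (m + 1) L, (((periodizedPotential v L (X p - X q)).toReal : ℝ) : ℂ) *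
        (conj (fourierAvg m L n i ψ X) * fourierAvg m L n j ψ X) =
      conj (∫ X in cellN (m + 1) L, (((periodizedPotential v L (X p - X q)).toReal : ℝ) : ℂ) *
        (conj (cellWave L n (X i) * cellAvg (m + 1) L i (fourierAvg m L n j ψ) X) * ψ X)) := by
  rw [form_down_adjoint n i (continuous_pairWeight hv hfc hL p q) (pairWeight_update v L hip hiq) hψ
    (continuous_fourierAvg n j hψ), form_conj_symm]

/-- **Entries `i ∈ {p,q}`, `j ∉ {p,q}` vanish, first half**: `𝓥_pq(b_iψ, b_jψ) = 𝓥_pq(b_i(P_j^{(n)}ψ), ψ)`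
(adjointness in slot `j` and the mixed commutation `b_i P_j^{(n)} = P_j^{(n)} b_i`). [folklore] -/
theorem pair_t1_eq_t3 (hv : IsRepulsiveFiniteRange v) (hfc : IsFiniteContinuous v) (hL : L ≠ 0)
    (n : Fin 3 → ℤ) {i j : Fin (m + 1)} (hij : i ≠ j) (hjp : p ≠ j) (hjq : q ≠ j) (hψ : Continuous ψ) :
    ∫ X in cellN (m + 1) L, (((periodizedPotential v L (X p - X q)).toReal : ℝ) : ℂ) *
        (conj (cellWave L n (X i) * cellAvg (m + 1) L i ψ X) * (cellWave L n (X j) * cellAvg (m + 1) L j ψ X)) =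
      ∫ X in cellN (m + 1) L, (((periodizedPotential v L (X p - X q)).toReal : ℝ) : ℂ) *
        (conj (cellWave L n (X i) * cellAvg (m + 1) L i (fourierAvg m L n j ψ) X) * ψ X) := by
  rw [form_conj_symm _ (fun X => cellWave L n (X j) * cellAvg (m + 1) L j ψ X),
    form_up_adjoint n j (continuous_pairWeight hv hfc hL p q) (pairWeight_update v L hjp hjq) hψ
      (continuous_up n i hψ), form_conj_symm _ _ ψ, Complex.conj_conj, ← up_down_comm n hij hψ]

/-- **Entries `i ∈ {p,q}`, `j ∉ {p,q}` vanish, second half**: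
`𝓥_pq(P_i^{(n)}ψ, P_j^{(n)}ψ) = 𝓥_pq(P_i^{(n)}(b_jψ), ψ)`. [folklore] -/
theorem pair_t2_eq_t4 (hv : IsRepulsiveFiniteRange v) (hfc : IsFiniteContinuous v) (hL : L ≠ 0)
    (n : Fin 3 → ℤ) {i j : Fin (m + 1)} (hij : i ≠ j) (hjp : p ≠ j) (hjq : q ≠ j) (hψ : Continuous ψ) :
    ∫ X in cellN (m + 1) L, (((periodizedPotential v L (X p - X q)).toReal : ℝ) : ℂ) *
        (conj (fourierAvg m L n i ψ X) * fourierAvg m L n j ψ X) =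
      ∫ X in cellN (m + 1) L, (((periodizedPotential v L (X p - X q)).toReal : ℝ) : ℂ) *
        (conj (fourierAvg m L n i (fun Y => cellWave L n (Y j) * cellAvg (m + 1) L j ψ Y) X) * ψ X) := by
  rw [form_conj_symm _ (fourierAvg m L n j ψ),
    form_down_adjoint n j (continuous_pairWeight hv hfc hL p q) (pairWeight_update v L hjp hjq) hψ
      (continuous_fourierAvg n i hψ), form_conj_symm _ _ ψ, Complex.conj_conj, ← up_down_comm n hij.symm hψ]

/-- **Jensen bound for a flat unit-mass function**: `∫ v^per_{pq}|h|² ≤ L⁻³‖v‖₁` for continuous `h` flat in a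
slot of the pair with `∫|h|² ≤ 1`. [folklore] -/
theorem integral_pairWeight_norm_sq_le (hL : 0 < L) (hv : IsRepulsiveFiniteRange v) (hfc : IsFiniteContinuous v)
    (hpq : p ≠ q) {k : Fin (m + 1)} (hk : k = p ∨ k = q) {h : Config (m + 1) → ℂ} (hh : Continuous h)
    (hflat : ∀ X z, h (Function.update X k z) = h X) (h1 : ∫ X in cellN (m + 1) L, ‖h X‖ ^ 2 ≤ 1) :
    ∫ X in cellN (m + 1) L, (periodizedPotential v L (X p - X q)).toReal * ‖h X‖ ^ 2 ≤
      ((ENNReal.ofReal (L ^ 3))⁻¹ * ∫⁻ x : Space, v ‖x‖).toReal := by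
  rw [integral_pairWeight_norm_sq_flat hL hv hfc hpq hk hh hflat]
  exact (mul_le_mul_of_nonneg_left h1 ENNReal.toReal_nonneg).trans_eq (mul_one _)

variable (hL : 0 < L) (hv : IsRepulsiveFiniteRange v) (hfc : IsFiniteContinuous v) (hpq : p ≠ q)
  (hψ : Continuous ψ) (hψ1 : ∫ X in cellN (m + 1) L, ‖ψ X‖ ^ 2 ≤ 1)
include hL hv hfc hpq hψ hψ1

/-- `∫ v^per_{pq}|b_kψ|² ≤ L⁻³‖v‖₁` for `k ∈ {p,q}` (`|b_kψ| = |P_kψ|` is flat in slot `k`). [folklore] -/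
theorem pair_sq_up_le (n : Fin 3 → ℤ) {k : Fin (m + 1)} (hk : k = p ∨ k = q) :
    ∫ X in cellN (m + 1) L, (periodizedPotential v L (X p - X q)).toReal *
        ‖cellWave L n (X k) * cellAvg (m + 1) L k ψ X‖ ^ 2 ≤
      ((ENNReal.ofReal (L ^ 3))⁻¹ * ∫⁻ x : Space, v ‖x‖).toReal := by
  simp only [norm_up]
  exact integral_pairWeight_norm_sq_le hL hv hfc hpq hk (continuous_cellAvg k hψ) (cellAvg_update k ψ)
    ((integral_norm_sq_cellAvg_le hL k hψ).trans hψ1)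

/-- `∫ v^per_{pq}|P_k^{(n)}ψ|² ≤ L⁻³‖v‖₁` for `k ∈ {p,q}`. [folklore] -/
theorem pair_sq_down_le (n : Fin 3 → ℤ) {k : Fin (m + 1)} (hk : k = p ∨ k = q) :
    ∫ X in cellN (m + 1) L, (periodizedPotential v L (X p - X q)).toReal * ‖fourierAvg m L n k ψ X‖ ^ 2 ≤
      ((ENNReal.ofReal (L ^ 3))⁻¹ * ∫⁻ x : Space, v ‖x‖).toReal :=
  integral_pairWeight_norm_sq_le hL hv hfc hpq hk (continuous_fourierAvg n k hψ) (fourierAvg_update n k ψ)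
    ((integral_norm_sq_fourierAvg_le hL n k hψ).trans hψ1)

/-- `∫ v^per_{pq}|b_k P_j^{(n)}ψ|² ≤ L⁻³‖v‖₁` for `k ∈ {p,q}`. [folklore] -/
theorem pair_sq_up_down_le (n : Fin 3 → ℤ) {k : Fin (m + 1)} (hk : k = p ∨ k = q) (j : Fin (m + 1)) :
    ∫ X in cellN (m + 1) L, (periodizedPotential v L (X p - X q)).toReal *
        ‖cellWave L n (X k) * cellAvg (m + 1) L k (fourierAvg m L n j ψ) X‖ ^ 2 ≤
      ((ENNReal.ofReal (L ^ 3))⁻¹ * ∫⁻ x : Space, v ‖x‖).toReal := by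
  have hF : Continuous (fourierAvg m L n j ψ) := continuous_fourierAvg n j hψ
  simp only [norm_up]
  exact integral_pairWeight_norm_sq_le hL hv hfc hpq hk (continuous_cellAvg k hF) (cellAvg_update k _)
    (((integral_norm_sq_cellAvg_le hL k hF).trans (integral_norm_sq_fourierAvg_le hL n j hψ)).trans hψ1)

/-- `∫ v^per_{pq}|P_k^{(n)} b_jψ|² ≤ L⁻³‖v‖₁` for `k ∈ {p,q}`. [folklore] -/
theorem pair_sq_down_up_le (n : Fin 3 → ℤ) {k : Fin (m + 1)} (hk : k = p ∨ k = q) (j : Fin (m + 1)) :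
    ∫ X in cellN (m + 1) L, (periodizedPotential v L (X p - X q)).toReal *
        ‖fourierAvg m L n k (fun Y => cellWave L n (Y j) * cellAvg (m + 1) L j ψ Y) X‖ ^ 2 ≤
      ((ENNReal.ofReal (L ^ 3))⁻¹ * ∫⁻ x : Space, v ‖x‖).toReal := by
  have hb : Continuous fun Y => cellWave L n (Y j) * cellAvg (m + 1) L j ψ Y := continuous_up n j hψ
  refine integral_pairWeight_norm_sq_le hL hv hfc hpq hk (continuous_fourierAvg n k hb) (fourierAvg_update n k _)
    (((integral_norm_sq_fourierAvg_le hL n k hb).trans ?_).trans hψ1)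
  simp only [norm_up]
  exact integral_norm_sq_cellAvg_le hL j hψ

/-- **The four local bounds** for `i, j ∈ {p,q}`: `|𝓥_pq(b_iψ,b_jψ)|, |𝓥_pq(P_i^{(n)}ψ,P_j^{(n)}ψ)| ≤ L⁻³‖v‖₁` and
`|𝓥_pq(b_iP_j^{(n)}ψ, ψ)|, |𝓥_pq(P_i^{(n)}b_jψ, ψ)| ≤ √(L⁻³‖v‖₁) √(∫v^per_{pq}|ψ|²)` (weighted Cauchy–Schwarz and
Jensen in a slot of the pair). [folklore] -/
theorem pair_local_bounds (n : Fin 3 → ℤ) {i j : Fin (m + 1)} (hi : i = p ∨ i = q) (hj : j = p ∨ j = q) :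
    ‖∫ X in cellN (m + 1) L, (((periodizedPotential v L (X p - X q)).toReal : ℝ) : ℂ) *
        (conj (cellWave L n (X i) * cellAvg (m + 1) L i ψ X) * (cellWave L n (X j) * cellAvg (m + 1) L j ψ X))‖ ≤
        ((ENNReal.ofReal (L ^ 3))⁻¹ * ∫⁻ x : Space, v ‖x‖).toReal ∧
    ‖∫ X in cellN (m + 1) L, (((periodizedPotential v L (X p - X q)).toReal : ℝ) : ℂ) *
        (conj (fourierAvg m L n i ψ X) * fourierAvg m L n j ψ X)‖ ≤
        ((ENNReal.ofReal (L ^ 3))⁻¹ * ∫⁻ x : Space, v ‖x‖).toReal ∧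
    ‖∫ X in cellN (m + 1) L, (((periodizedPotential v L (X p - X q)).toReal : ℝ) : ℂ) *
        (conj (cellWave L n (X i) * cellAvg (m + 1) L i (fourierAvg m L n j ψ) X) * ψ X)‖ ≤
        Real.sqrt ((ENNReal.ofReal (L ^ 3))⁻¹ * ∫⁻ x : Space, v ‖x‖).toReal *
          Real.sqrt (∫ X in cellN (m + 1) L, (periodizedPotential v L (X p - X q)).toReal * ‖ψ X‖ ^ 2) ∧
    ‖∫ X in cellN (m + 1) L, (((periodizedPotential v L (X p - X q)).toReal : ℝ) : ℂ) *
        (conj (fourierAvg m L n i (fun Y => cellWave L n (Y j) * cellAvg (m + 1) L j ψ Y) X) * ψ X)‖ ≤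
        Real.sqrt ((ENNReal.ofReal (L ^ 3))⁻¹ * ∫⁻ x : Space, v ‖x‖).toReal *
          Real.sqrt (∫ X in cellN (m + 1) L, (periodizedPotential v L (X p - X q)).toReal * ‖ψ X‖ ^ 2) := by
  have hW := continuous_pairWeight hv hfc hL.ne' p q (N := m + 1)
  have hW0 : ∀ X : Config (m + 1), 0 ≤ (periodizedPotential v L (X p - X q)).toReal := fun X =>
    ENNReal.toReal_nonneg
  have hσ : Real.sqrt ((ENNReal.ofReal (L ^ 3))⁻¹ * ∫⁻ x : Space, v ‖x‖).toReal *
      Real.sqrt ((ENNReal.ofReal (L ^ 3))⁻¹ * ∫⁻ x : Space, v ‖x‖).toReal =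
        ((ENNReal.ofReal (L ^ 3))⁻¹ * ∫⁻ x : Space, v ‖x‖).toReal := Real.mul_self_sqrt ENNReal.toReal_nonneg
  have hFc : ∀ k, Continuous (fourierAvg m L n k ψ) := fun k => continuous_fourierAvg n k hψ
  refine ⟨?_, ?_, ?_, ?_⟩
  · refine (norm_form_le_sqrt_mul_sqrt hW hW0 (continuous_up n i hψ) (continuous_up n j hψ)).trans ?_
    rw [← hσ]
    exact mul_le_mul (Real.sqrt_le_sqrt (pair_sq_up_le hL hv hfc hpq hψ hψ1 n hi))
      (Real.sqrt_le_sqrt (pair_sq_up_le hL hv hfc hpq hψ hψ1 n hj)) (Real.sqrt_nonneg _) (Real.sqrt_nonneg _)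
  · refine (norm_form_le_sqrt_mul_sqrt hW hW0 (hFc i) (hFc j)).trans ?_
    rw [← hσ]
    exact mul_le_mul (Real.sqrt_le_sqrt (pair_sq_down_le hL hv hfc hpq hψ hψ1 n hi))
      (Real.sqrt_le_sqrt (pair_sq_down_le hL hv hfc hpq hψ hψ1 n hj)) (Real.sqrt_nonneg _) (Real.sqrt_nonneg _)
  · refine (norm_form_le_sqrt_mul_sqrt hW hW0 (continuous_up n i (hFc j)) hψ).trans ?_
    exact mul_le_mul_of_nonneg_right (Real.sqrt_le_sqrt (pair_sq_up_down_le hL hv hfc hpq hψ hψ1 n hi j))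
      (Real.sqrt_nonneg _)
  · refine (norm_form_le_sqrt_mul_sqrt hW hW0 (continuous_fourierAvg n i (continuous_up n j hψ)) hψ).trans ?_
    exact mul_le_mul_of_nonneg_right (Real.sqrt_le_sqrt (pair_sq_down_up_le hL hv hfc hpq hψ hψ1 n hi j))
      (Real.sqrt_nonneg _)

end OnePair

/-! ## The `(i,j)`-expansion of the double-commutator form for a continuous weight -/

/-- **Expansion.**  For a continuous real weight `w` and continuous `ψ`, with `B = Σ_i b_i`, `B' = Σ_i P_i^{(n)}`:
`𝓥_w(Bψ,Bψ) + 𝓥_w(B'ψ,B'ψ) − 𝓥_w(BB'ψ,ψ) − 𝓥_w(B'Bψ,ψ) = Σ_{i,j}[𝓥_w(b_iψ,b_jψ) + 𝓥_w(P_i^{(n)}ψ,P_j^{(n)}ψ)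
− 𝓥_w(b_iP_j^{(n)}ψ,ψ) − 𝓥_w(P_i^{(n)}b_jψ,ψ)]` (sesquilinearity; `P_i`, `P_i^{(n)}` through finite sums). [folklore] -/
theorem bracket_expand {w : Config (m + 1) → ℝ} (hw : Continuous w) (n : Fin 3 → ℤ) {ψ : Config (m + 1) → ℂ}
    (hψ : Continuous ψ) :
    ((∫ X in cellN (m + 1) L, ((w X : ℝ) : ℂ) *
        (conj (∑ i, cellWave L n (X i) * cellAvg (m + 1) L i ψ X) *
          ∑ i, cellWave L n (X i) * cellAvg (m + 1) L i ψ X)) +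
      (∫ X in cellN (m + 1) L, ((w X : ℝ) : ℂ) *
        (conj (∑ i, fourierAvg m L n i ψ X) * ∑ i, fourierAvg m L n i ψ X)) -
      (∫ X in cellN (m + 1) L, ((w X : ℝ) : ℂ) *
        (conj (∑ i, cellWave L n (X i) *
          cellAvg (m + 1) L i (fun Y => ∑ j, fourierAvg m L n j ψ Y) X) * ψ X)) -
      ∫ X in cellN (m + 1) L, ((w X : ℝ) : ℂ) *
        (conj (∑ i, fourierAvg m L n i (fun Y => ∑ j, cellWave L n (Y j) * cellAvg (m + 1) L j ψ Y) X) *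
          ψ X)) =
      ∑ i, ∑ j,
        ((∫ X in cellN (m + 1) L, ((w X : ℝ) : ℂ) *
            (conj (cellWave L n (X i) * cellAvg (m + 1) L i ψ X) *
              (cellWave L n (X j) * cellAvg (m + 1) L j ψ X))) +
          (∫ X in cellN (m + 1) L, ((w X : ℝ) : ℂ) * (conj (fourierAvg m L n i ψ X) * fourierAvg m L n j ψ X)) -
          (∫ X in cellN (m + 1) L, ((w X : ℝ) : ℂ) *
            (conj (cellWave L n (X i) * cellAvg (m + 1) L i (fourierAvg m L n j ψ) X) * ψ X)) -
          ∫ X in cellN (m + 1) L, ((w X : ℝ) : ℂ) *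
            (conj (fourierAvg m L n i (fun Y => cellWave L n (Y j) * cellAvg (m + 1) L j ψ Y) X) * ψ X)) := by
  have hb : ∀ i, Continuous fun X => cellWave L n (X i) * cellAvg (m + 1) L i ψ X := fun i => continuous_up n i hψ
  have hF : ∀ i, Continuous (fourierAvg m L n i ψ) := fun i => continuous_fourierAvg n i hψ
  have hbF : ∀ i j, Continuous fun X => cellWave L n (X i) * cellAvg (m + 1) L i (fourierAvg m L n j ψ) X :=
    fun i j => continuous_up n i (hF j)
  have hFb : ∀ i j, Continuous (fourierAvg m L n i fun Y => cellWave L n (Y j) * cellAvg (m + 1) L j ψ Y) :=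
    fun i j => continuous_fourierAvg n i (hb j)
  -- `BB'ψ` and `B'Bψ` as double sums
  have hBB' : (fun X => ∑ i, cellWave L n (X i) * cellAvg (m + 1) L i (fun Y => ∑ j, fourierAvg m L n j ψ Y) X) =
      fun X => ∑ i, ∑ j, cellWave L n (X i) * cellAvg (m + 1) L i (fourierAvg m L n j ψ) X := by
    funext X
    refine Finset.sum_congr rfl fun i _ => ?_
    rw [cellAvg_sum Finset.univ (fun j _ => hF j) i, Finset.mul_sum]
  have hB'B : (fun X => ∑ i, fourierAvg m L n i (fun Y => ∑ j, cellWave L n (Y j) * cellAvg (m + 1) L j ψ Y) X) =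
      fun X => ∑ i, ∑ j, fourierAvg m L n i (fun Y => cellWave L n (Y j) * cellAvg (m + 1) L j ψ Y) X := by
    funext X
    refine Finset.sum_congr rfl fun i _ => ?_
    rw [fourierAvg_sum Finset.univ n (fun j _ => hb j) i]
  have e3 : (∫ X in cellN (m + 1) L, ((w X : ℝ) : ℂ) *
      (conj (∑ i, cellWave L n (X i) * cellAvg (m + 1) L i (fun Y => ∑ j, fourierAvg m L n j ψ Y) X) * ψ X)) =
        ∑ i, ∑ j, ∫ X in cellN (m + 1) L, ((w X : ℝ) : ℂ) *
          (conj (cellWave L n (X i) * cellAvg (m + 1) L i (fourierAvg m L n j ψ) X) * ψ X) := by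
    have h := congrFun hBB'
    simp_rw [h]
    rw [form_sum_left _ hw (fun i _ => continuous_finsetSum _ fun j _ => hbF i j) hψ]
    exact Finset.sum_congr rfl fun i _ => form_sum_left _ hw (fun j _ => hbF i j) hψ
  have e4 : (∫ X in cellN (m + 1) L, ((w X : ℝ) : ℂ) *
      (conj (∑ i, fourierAvg m L n i (fun Y => ∑ j, cellWave L n (Y j) * cellAvg (m + 1) L j ψ Y) X) * ψ X)) =
        ∑ i, ∑ j, ∫ X in cellN (m + 1) L, ((w X : ℝ) : ℂ) *
          (conj (fourierAvg m L n i (fun Y => cellWave L n (Y j) * cellAvg (m + 1) L j ψ Y) X) * ψ X) := by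
    have h := congrFun hB'B
    simp_rw [h]
    rw [form_sum_left _ hw (fun i _ => continuous_finsetSum _ fun j _ => hFb i j) hψ]
    exact Finset.sum_congr rfl fun i _ => form_sum_left _ hw (fun j _ => hFb i j) hψ
  have e1 : (∫ X in cellN (m + 1) L, ((w X : ℝ) : ℂ) *
      (conj (∑ i, cellWave L n (X i) * cellAvg (m + 1) L i ψ X) * ∑ i, cellWave L n (X i) * cellAvg (m + 1) L i ψ X)) =
        ∑ i, ∑ j, ∫ X in cellN (m + 1) L, ((w X : ℝ) : ℂ) *
          (conj (cellWave L n (X i) * cellAvg (m + 1) L i ψ X) * (cellWave L n (X j) * cellAvg (m + 1) L j ψ X)) := by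
    rw [form_sum_left _ hw (fun i _ => hb i) (continuous_finsetSum _ fun j _ => hb j)]
    exact Finset.sum_congr rfl fun i _ => form_sum_right _ hw (hb i) (fun j _ => hb j)
  have e2 : (∫ X in cellN (m + 1) L, ((w X : ℝ) : ℂ) *
      (conj (∑ i, fourierAvg m L n i ψ X) * ∑ i, fourierAvg m L n i ψ X)) =
        ∑ i, ∑ j, ∫ X in cellN (m + 1) L, ((w X : ℝ) : ℂ) *
          (conj (fourierAvg m L n i ψ X) * fourierAvg m L n j ψ X) := by
    rw [form_sum_left _ hw (fun i _ => hF i) (continuous_finsetSum _ fun j _ => hF j)]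
    exact Finset.sum_congr rfl fun i _ => form_sum_right _ hw (hF i) (fun j _ => hF j)
  rw [e1, e2, e3, e4]
  simp only [Finset.sum_add_distrib, Finset.sum_sub_distrib]

/-- **The local bound of one pair.**  For `p ≠ q`, continuous `ψ` with `∫|ψ|² ≤ 1` and the pair weight
`v^per(x_p − x_q)`: `|Re 𝒟^{pq}| ≤ 8(L⁻³‖v‖₁) + 8√(L⁻³‖v‖₁)√(∫v^per_{pq}|ψ|²)` — rows `i ∉ {p,q}` are purely imaginary,
entries `i ∈ {p,q} ∌ j` vanish, and the four `(i,j) ∈ {p,q}²` carry the Jensen/Cauchy–Schwarz bounds. [folklore] -/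
theorem abs_re_pairBracket_le {v : ℝ → ℝ≥0∞} (hL : 0 < L) (hv : IsRepulsiveFiniteRange v)
    (hfc : IsFiniteContinuous v) (n : Fin 3 → ℤ) {p q : Fin (m + 1)} (hpq : p ≠ q) {ψ : Config (m + 1) → ℂ}
    (hψ : Continuous ψ) (hψ1 : ∫ X in cellN (m + 1) L, ‖ψ X‖ ^ 2 ≤ 1) :
    |((∫ X in cellN (m + 1) L, (((periodizedPotential v L (X p - X q)).toReal : ℝ) : ℂ) *
        (conj (∑ i, cellWave L n (X i) * cellAvg (m + 1) L i ψ X) *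
          ∑ i, cellWave L n (X i) * cellAvg (m + 1) L i ψ X)) +
      (∫ X in cellN (m + 1) L, (((periodizedPotential v L (X p - X q)).toReal : ℝ) : ℂ) *
        (conj (∑ i, fourierAvg m L n i ψ X) * ∑ i, fourierAvg m L n i ψ X)) -
      (∫ X in cellN (m + 1) L, (((periodizedPotential v L (X p - X q)).toReal : ℝ) : ℂ) *
        (conj (∑ i, cellWave L n (X i) *
          cellAvg (m + 1) L i (fun Y => ∑ j, fourierAvg m L n j ψ Y) X) * ψ X)) -
      ∫ X in cellN (m + 1) L, (((periodizedPotential v L (X p - X q)).toReal : ℝ) : ℂ) *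
        (conj (∑ i, fourierAvg m L n i (fun Y => ∑ j, cellWave L n (Y j) * cellAvg (m + 1) L j ψ Y) X) *
          ψ X)).re| ≤
      8 * ((ENNReal.ofReal (L ^ 3))⁻¹ * ∫⁻ x : Space, v ‖x‖).toReal +
        8 * (Real.sqrt ((ENNReal.ofReal (L ^ 3))⁻¹ * ∫⁻ x : Space, v ‖x‖).toReal *
          Real.sqrt (∫ X in cellN (m + 1) L, (periodizedPotential v L (X p - X q)).toReal * ‖ψ X‖ ^ 2)) := by
  classical
  rw [bracket_expand (continuous_pairWeight hv hfc hL.ne' p q) n hψ]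
  have hA : (({p, q} : Finset (Fin (m + 1))).card : ℝ) = 2 := by
    rw [Finset.card_pair hpq, Nat.cast_ofNat]
  have hmem : ∀ k : Fin (m + 1), k ∈ ({p, q} : Finset (Fin (m + 1))) ↔ k = p ∨ k = q := fun k => by
    rw [Finset.mem_insert, Finset.mem_singleton]
  have key := abs_re_sum_sum_le ({p, q} : Finset (Fin (m + 1)))
    (fun i j => ∫ X in cellN (m + 1) L, (((periodizedPotential v L (X p - X q)).toReal : ℝ) : ℂ) *
      (conj (cellWave L n (X i) * cellAvg (m + 1) L i ψ X) * (cellWave L n (X j) * cellAvg (m + 1) L j ψ X)))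
    (fun i j => ∫ X in cellN (m + 1) L, (((periodizedPotential v L (X p - X q)).toReal : ℝ) : ℂ) *
      (conj (fourierAvg m L n i ψ X) * fourierAvg m L n j ψ X))
    (fun i j => ∫ X in cellN (m + 1) L, (((periodizedPotential v L (X p - X q)).toReal : ℝ) : ℂ) *
      (conj (cellWave L n (X i) * cellAvg (m + 1) L i (fourierAvg m L n j ψ) X) * ψ X))
    (fun i j => ∫ X in cellN (m + 1) L, (((periodizedPotential v L (X p - X q)).toReal : ℝ) : ℂ) *
      (conj (fourierAvg m L n i (fun Y => cellWave L n (Y j) * cellAvg (m + 1) L j ψ Y) X) * ψ X))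
    (σ := ((ENNReal.ofReal (L ^ 3))⁻¹ * ∫⁻ x : Space, v ‖x‖).toReal)
    (e := ∫ X in cellN (m + 1) L, (periodizedPotential v L (X p - X q)).toReal * ‖ψ X‖ ^ 2)
    (fun i hi j => by
      rw [hmem, not_or] at hi
      exact ⟨pair_t1_eq_conj_t4 hv hfc hL.ne' n (Ne.symm hi.1) (Ne.symm hi.2) j hψ,
        pair_t2_eq_conj_t3 hv hfc hL.ne' n (Ne.symm hi.1) (Ne.symm hi.2) j hψ⟩)
    (fun i hi j hj => by
      rw [hmem] at hi
      rw [hmem, not_or] at hj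
      have hij : i ≠ j := by
        rintro rfl
        rcases hi with rfl | rfl
        · exact hj.1 rfl
        · exact hj.2 rfl
      exact ⟨pair_t1_eq_t3 hv hfc hL.ne' n hij (Ne.symm hj.1) (Ne.symm hj.2) hψ,
        pair_t2_eq_t4 hv hfc hL.ne' n hij (Ne.symm hj.1) (Ne.symm hj.2) hψ⟩)
    (fun i hi j hj => pair_local_bounds hL hv hfc hpq hψ hψ1 n ((hmem i).1 hi) ((hmem j).1 hj))
  rw [hA] at key
  refine key.trans_eq ?_
  ring

end PlainInteraction

/-- **Part 3 of `stub_plainInteraction` (registered helper statement)**: the local bound of one pair — for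
`p ≠ q`, continuous `ψ` with `∫|ψ|² ≤ 1` and the pair weight `v^per(x_p − x_q)` of a finite continuous finite-range
profile, `|Re 𝒟^{pq}(ψ)| ≤ 8(L⁻³‖v‖₁) + 8√(L⁻³‖v‖₁)√(∫v^per_pq|ψ|²)` with `B = Σ_i b_i`, `B' = Σ_i P_i^{(n)}`. [folklore]
(KennedyLiebShastry1988 §2; arXiv:1211.2778 §2; LSSY2005 App. A) -/
theorem plainInteraction_abs_re_pairBracket_le :
    ∀ (v : ℝ → ENNReal) (m : ℕ) (L : ℝ), 0 < L →
      Literature.MathematicalPhysics.QuantumManyBody.BoseGas.IsRepulsiveFiniteRange v → IsFiniteContinuous v →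
      ∀ (n : Fin 3 → ℤ) (p q : Fin (m + 1)), p ≠ q →
      ∀ (ψ : Literature.MathematicalPhysics.QuantumManyBody.BoseGas.Config (m + 1) → ℂ), Continuous ψ →
      ∫ X in Literature.MathematicalPhysics.QuantumManyBody.BoseGas.cellN (m + 1) L, ‖ψ X‖ ^ 2 ≤ 1 →
        |((∫ X in Literature.MathematicalPhysics.QuantumManyBody.BoseGas.cellN (m + 1) L,
              (((Literature.MathematicalPhysics.QuantumManyBody.BoseGas.periodizedPotential v L (X p - X q)).toReal : ℝ) : ℂ) *
                (conj (∑ i, Literature.MathematicalPhysics.QuantumManyBody.BoseGas.cellWave L n (X i) *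
                    Summit.AtomisticToContinuum.BoseEinsteinCondensation.Theorems.GaussianDominationCan.Negative.cellAvg
                      (m + 1) L i ψ X) *
                  ∑ i, Literature.MathematicalPhysics.QuantumManyBody.BoseGas.cellWave L n (X i) *
                    Summit.AtomisticToContinuum.BoseEinsteinCondensation.Theorems.GaussianDominationCan.Negative.cellAvg
                      (m + 1) L i ψ X)) +
            (∫ X in Literature.MathematicalPhysics.QuantumManyBody.BoseGas.cellN (m + 1) L,
              (((Literature.MathematicalPhysics.QuantumManyBody.BoseGas.periodizedPotential v L (X p - X q)).toReal : ℝ) : ℂ) *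
                (conj (∑ i,
                    Summit.AtomisticToContinuum.BoseEinsteinCondensation.Cruxes.GDTransfer.DysonDressedWitness.fourierAvg
                      m L n i ψ X) *
                  ∑ i,
                    Summit.AtomisticToContinuum.BoseEinsteinCondensation.Cruxes.GDTransfer.DysonDressedWitness.fourierAvg
                      m L n i ψ X)) -
            (∫ X in Literature.MathematicalPhysics.QuantumManyBody.BoseGas.cellN (m + 1) L,
              (((Literature.MathematicalPhysics.QuantumManyBody.BoseGas.periodizedPotential v L (X p - X q)).toReal : ℝ) : ℂ) *
                (conj (∑ i, Literature.MathematicalPhysics.QuantumManyBody.BoseGas.cellWave L n (X i) *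
                    Summit.AtomisticToContinuum.BoseEinsteinCondensation.Theorems.GaussianDominationCan.Negative.cellAvg
                      (m + 1) L i (fun Y => ∑ j,
                        Summit.AtomisticToContinuum.BoseEinsteinCondensation.Cruxes.GDTransfer.DysonDressedWitness.fourierAvg
                          m L n j ψ Y) X) * ψ X)) -
            ∫ X in Literature.MathematicalPhysics.QuantumManyBody.BoseGas.cellN (m + 1) L,
              (((Literature.MathematicalPhysics.QuantumManyBody.BoseGas.periodizedPotential v L (X p - X q)).toReal : ℝ) : ℂ) *
                (conj (∑ i,
                    Summit.AtomisticToContinuum.BoseEinsteinCondensation.Cruxes.GDTransfer.DysonDressedWitness.fourierAvg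
                      m L n i (fun Y => ∑ j, Literature.MathematicalPhysics.QuantumManyBody.BoseGas.cellWave L n (Y j) *
                        Summit.AtomisticToContinuum.BoseEinsteinCondensation.Theorems.GaussianDominationCan.Negative.cellAvg
                          (m + 1) L j ψ Y) X) * ψ X)).re| ≤
          8 * ((ENNReal.ofReal (L ^ 3))⁻¹ *
                ∫⁻ x : Literature.MathematicalPhysics.QuantumManyBody.BoseGas.Space, v ‖x‖).toReal +
            8 * (Real.sqrt ((ENNReal.ofReal (L ^ 3))⁻¹ *
                  ∫⁻ x : Literature.MathematicalPhysics.QuantumManyBody.BoseGas.Space, v ‖x‖).toReal *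
              Real.sqrt (∫ X in Literature.MathematicalPhysics.QuantumManyBody.BoseGas.cellN (m + 1) L,
                (Literature.MathematicalPhysics.QuantumManyBody.BoseGas.periodizedPotential v L (X p - X q)).toReal * ‖ψ X‖ ^ 2)) :=
  fun _ _ _ hL hv hfc n _ _ hpq _ hψ hψ1 => PlainInteraction.abs_re_pairBracket_le hL hv hfc n hpq hψ hψ1

end Summit.AtomisticToContinuum.BoseEinsteinCondensation.Cruxes.GDTransfer.Seeded

end
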